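import Mathlib
import Summits.NavierStokesRegularity.NavierStokesRegularity.Theorems.EulerZoomLiouvillePowerGaugeEulerLiouvilleHoopAxisRadialLaw
import Summits.NavierStokesRegularity.NavierStokesRegularity.Theorems.EulerZoomLiouvillePowerGaugeEulerLiouvilleHoopAxisAtom

/-!
# Hoop core — K-AXIS AX-3: the radial law integrated in the radius (general centre), with the axis atom

Sub-problem `NavierStokesRegularity`, crux `PowerGaugeEulerLiouville` (a crux CLASS of self-similar Euler/NS strata — not NS
regularity; everything here holds for ANY `C²` self-similar Euler profile `IsSelfSimilarEulerProfile γ c V P`).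

AX-2 (`…HoopAxisRadialLaw.radialLaw_circleAvg`, the circle-averaged radial law at radius `t > 0`) integrated over
`t ∈ (0, T₀]` at fixed height `σ`.  Device (from `…HoopSliceChart`): along `axisPt σ t θ` use the SMOOTH frame `R_θe₀, R_θe₁, e_z`
(every `t`), so circle averages are `θ`-integrals of functions jointly continuous in `(t, θ)` on the whole line; the axis atom is a
VALUE at `t = 0` (`sliceRadialFlux_zero`: `½(‖V(σe_z)‖² − V_z(σe_z)²)`), and `sliceSqDiff_zero` makes `t⁻¹·circleAvg(V_r² − V_θ²)`
bounded, hence integrable at the axis.  Main result `axisLaw_slice` (AX-3); the last term of its right side is the `t`-integral of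
the `σ`-derivatives (`hasDerivAt_sliceEndFlux_height`, `hasDerivAt_sliceOffsetFlux_height`) of the slice forms of the `endTermC` /
`offsetTerm` integrands (`circleAvg_endFlux_eq_slice`, `circleAvg_offsetFlux_eq_slice`), so AX-4 (σ-integration, Fubini, FTC in σ)
yields `AxisLawCentre γ` of `…HoopDefs`.
-/

noncomputable section

set_option linter.dupNamespace false

open Set Function WithLp Metric Filter Topology MeasureTheory intervalIntegral
open scoped InnerProductSpace RealInnerProductSpace

namespace Summit.NavierStokesRegularity.NavierStokesRegularity.Theorems.PowerGaugeEulerLiouville.HoopCore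

open Literature.Analysis Literature.Analysis.FluidPDE

variable {γ : ℝ} {c : EuclideanSpace ℝ (Fin 3)} {V : EuclideanSpace ℝ (Fin 3) → EuclideanSpace ℝ (Fin 3)}
  {P : EuclideanSpace ℝ (Fin 3) → ℝ}

/-! ### Trigonometric integrals over one period and the two axis values -/

/-- `∫₀^{2π} (v₀cos θ + v₁sin θ)² dθ = π(v₀² + v₁²)`. [folklore] -/
theorem integral_sq_linear_trig (v₀ v₁ : ℝ) :
    ∫ θ in (0 : ℝ)..(2 * Real.pi), (v₀ * Real.cos θ + v₁ * Real.sin θ) ^ 2 = Real.pi * (v₀ ^ 2 + v₁ ^ 2) := by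
  have e : (fun θ => (v₀ * Real.cos θ + v₁ * Real.sin θ) ^ 2) =
      fun θ => v₀ ^ 2 * Real.cos θ ^ 2 + v₁ ^ 2 * Real.sin θ ^ 2 + (2 * v₀ * v₁) * (Real.sin θ * Real.cos θ) := by
    funext θ; ring
  have i1 : IntervalIntegrable (fun θ => v₀ ^ 2 * Real.cos θ ^ 2) volume (0 : ℝ) (2 * Real.pi) :=
    (by fun_prop : Continuous fun θ => v₀ ^ 2 * Real.cos θ ^ 2).intervalIntegrable _ _
  have i2 : IntervalIntegrable (fun θ => v₁ ^ 2 * Real.sin θ ^ 2) volume (0 : ℝ) (2 * Real.pi) :=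
    (by fun_prop : Continuous fun θ => v₁ ^ 2 * Real.sin θ ^ 2).intervalIntegrable _ _
  have i3 : IntervalIntegrable (fun θ => (2 * v₀ * v₁) * (Real.sin θ * Real.cos θ)) volume (0 : ℝ) (2 * Real.pi) :=
    (by fun_prop : Continuous fun θ => (2 * v₀ * v₁) * (Real.sin θ * Real.cos θ)).intervalIntegrable _ _
  rw [e, integral_add (i1.add i2) i3, integral_add i1 i2, intervalIntegral.integral_const_mul,
    intervalIntegral.integral_const_mul, intervalIntegral.integral_const_mul,
    integral_cos_sq_two_pi, integral_sin_sq_two_pi, integral_sin_mul_cos_two_pi]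
  ring

/-- `∫₀^{2π} ((v₀cos θ + v₁sin θ)² − (−v₀sin θ + v₁cos θ)²) dθ = 0` (the `m = 2` modes average out). [folklore] -/
theorem integral_sq_diff_linear_trig (v₀ v₁ : ℝ) :
    ∫ θ in (0 : ℝ)..(2 * Real.pi), ((v₀ * Real.cos θ + v₁ * Real.sin θ) ^ 2 - (-(v₀ * Real.sin θ) + v₁ * Real.cos θ) ^ 2) = 0 := by
  have e : (fun θ => (v₀ * Real.cos θ + v₁ * Real.sin θ) ^ 2 - (-(v₀ * Real.sin θ) + v₁ * Real.cos θ) ^ 2) =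
      fun θ => (v₀ ^ 2 - v₁ ^ 2) * Real.cos θ ^ 2 - (v₀ ^ 2 - v₁ ^ 2) * Real.sin θ ^ 2 + (4 * v₀ * v₁) * (Real.sin θ * Real.cos θ) := by
    funext θ; ring
  have i1 : IntervalIntegrable (fun θ => (v₀ ^ 2 - v₁ ^ 2) * Real.cos θ ^ 2) volume (0 : ℝ) (2 * Real.pi) :=
    (by fun_prop : Continuous fun θ => (v₀ ^ 2 - v₁ ^ 2) * Real.cos θ ^ 2).intervalIntegrable _ _
  have i2 : IntervalIntegrable (fun θ => (v₀ ^ 2 - v₁ ^ 2) * Real.sin θ ^ 2) volume (0 : ℝ) (2 * Real.pi) :=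
    (by fun_prop : Continuous fun θ => (v₀ ^ 2 - v₁ ^ 2) * Real.sin θ ^ 2).intervalIntegrable _ _
  have i3 : IntervalIntegrable (fun θ => (4 * v₀ * v₁) * (Real.sin θ * Real.cos θ)) volume (0 : ℝ) (2 * Real.pi) :=
    (by fun_prop : Continuous fun θ => (4 * v₀ * v₁) * (Real.sin θ * Real.cos θ)).intervalIntegrable _ _
  rw [e, integral_add (i1.sub i2) i3, integral_sub i1 i2, intervalIntegral.integral_const_mul,
    intervalIntegral.integral_const_mul, intervalIntegral.integral_const_mul,
    integral_cos_sq_two_pi, integral_sin_sq_two_pi, integral_sin_mul_cos_two_pi]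
  ring

/-- **THE AXIS ATOM**: `(2π)⁻¹ ∫₀^{2π} (γ·0 + ⟪V(σe_z), R_θe₀⟫)⟪V(σe_z), R_θe₀⟫ dθ = ½(‖V(σe_z)‖² − V_z(σe_z)²)`. [folklore] -/
theorem sliceRadialFlux_zero (γ : ℝ) (V : EuclideanSpace ℝ (Fin 3) → EuclideanSpace ℝ (Fin 3)) (σ : ℝ) :
    (1 / (2 * Real.pi)) * ∫ θ in (0 : ℝ)..(2 * Real.pi), (γ * 0 + ⟪V (axisPt σ 0 θ), rotZ θ (EuclideanSpace.single (0 : Fin 3) (1 : ℝ))⟫) * ⟪V (axisPt σ 0 θ), rotZ θ (EuclideanSpace.single (0 : Fin 3) (1 : ℝ))⟫ =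
      (1 / 2) * (‖V (σ • eZ)‖ ^ 2 - axialVelocity V (σ • eZ) ^ 2) := by
  simp_rw [axisPt_radius_zero, inner_rotZ_single_zero, mul_zero, zero_add, ← sq]
  rw [integral_sq_linear_trig, EuclideanSpace.real_norm_sq_eq, Fin.sum_univ_three, axialVelocity]
  field_simp
  ring

/-- At the axis the `m = 2` combination vanishes: `∫₀^{2π} (⟪V(σe_z), R_θe₀⟫² − ⟪V(σe_z), R_θe₁⟫²) dθ = 0`. [folklore] -/
theorem sliceSqDiff_zero (V : EuclideanSpace ℝ (Fin 3) → EuclideanSpace ℝ (Fin 3)) (σ : ℝ) :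
    ∫ θ in (0 : ℝ)..(2 * Real.pi), (⟪V (axisPt σ 0 θ), rotZ θ (EuclideanSpace.single (0 : Fin 3) (1 : ℝ))⟫ ^ 2 - ⟪V (axisPt σ 0 θ), rotZ θ (EuclideanSpace.single (1 : Fin 3) (1 : ℝ))⟫ ^ 2) = 0 := by
  simp_rw [axisPt_radius_zero, inner_rotZ_single_zero, inner_rotZ_single_one]
  exact integral_sq_diff_linear_trig _ _

/-! ### Slice forms of the circle averages (`t > 0`) -/

/-- `circleAvg V_r σ t = (2π)⁻¹∫⟪V, R_θe₀⟫` (`t > 0`). [folklore] -/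
theorem circleAvg_radialVelocity_eq_slice (V : EuclideanSpace ℝ (Fin 3) → EuclideanSpace ℝ (Fin 3)) (σ : ℝ) {t : ℝ}
    (ht : 0 < t) : circleAvg (radialVelocity V) σ t = (1 / (2 * Real.pi)) * ∫ θ in (0 : ℝ)..(2 * Real.pi), ⟪V (axisPt σ t θ), rotZ θ (EuclideanSpace.single (0 : Fin 3) (1 : ℝ))⟫ := by
  unfold circleAvg
  congr 1
  exact intervalIntegral.integral_congr fun θ _ => (inner_rotZ_single_zero_eq_radialVelocity V σ ht θ).symm

/-- `circleAvg (V_r² − V_θ²) σ t = (2π)⁻¹∫(⟪V,R_θe₀⟫² − ⟪V,R_θe₁⟫²)` (`t > 0`). [folklore] -/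
theorem circleAvg_sqDiff_eq_slice (V : EuclideanSpace ℝ (Fin 3) → EuclideanSpace ℝ (Fin 3)) (σ : ℝ) {t : ℝ} (ht : 0 < t) :
    circleAvg (fun y => radialVelocity V y ^ 2 - swirlVelocity V y ^ 2) σ t =
      (1 / (2 * Real.pi)) * ∫ θ in (0 : ℝ)..(2 * Real.pi), (⟪V (axisPt σ t θ), rotZ θ (EuclideanSpace.single (0 : Fin 3) (1 : ℝ))⟫ ^ 2 - ⟪V (axisPt σ t θ), rotZ θ (EuclideanSpace.single (1 : Fin 3) (1 : ℝ))⟫ ^ 2) := by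
  unfold circleAvg
  congr 1
  refine intervalIntegral.integral_congr fun θ _ => ?_
  simp only [inner_rotZ_single_zero_eq_radialVelocity V σ ht θ, inner_rotZ_single_one_eq_swirlVelocity V σ ht θ]

/-- `circleAvg ((γr + V_r)V_r) σ t = (2π)⁻¹∫(γt + ⟪V,R_θe₀⟫)⟪V,R_θe₀⟫` (`t > 0`). [folklore] -/
theorem circleAvg_radialFlux_eq_slice (γ : ℝ) (V : EuclideanSpace ℝ (Fin 3) → EuclideanSpace ℝ (Fin 3)) (σ : ℝ) {t : ℝ}
    (ht : 0 < t) :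
    circleAvg (fun y => (γ * cylRadius y + radialVelocity V y) * radialVelocity V y) σ t = (1 / (2 * Real.pi)) * ∫ θ in (0 : ℝ)..(2 * Real.pi), (γ * t + ⟪V (axisPt σ t θ), rotZ θ (EuclideanSpace.single (0 : Fin 3) (1 : ℝ))⟫) * ⟪V (axisPt σ t θ), rotZ θ (EuclideanSpace.single (0 : Fin 3) (1 : ℝ))⟫ := by
  unfold circleAvg
  congr 1
  refine intervalIntegral.integral_congr fun θ _ => ?_
  simp only [cylRadius_axisPt σ ht.le θ, inner_rotZ_single_zero_eq_radialVelocity V σ ht θ]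

/-- `circleAvg ((γ(y₂−c₂) + V_z)V_r) σ t = (2π)⁻¹∫(γ(σ−c₂) + V_z)⟪V,R_θe₀⟫` (`t > 0`; the `endTermC` integrand). [folklore] -/
theorem circleAvg_endFlux_eq_slice (γ : ℝ) (c : EuclideanSpace ℝ (Fin 3)) (V : EuclideanSpace ℝ (Fin 3) → EuclideanSpace ℝ (Fin 3))
    (σ : ℝ) {t : ℝ} (ht : 0 < t) :
    circleAvg (fun y => (γ * (y 2 - c 2) + axialVelocity V y) * radialVelocity V y) σ t = (1 / (2 * Real.pi)) * ∫ θ in (0 : ℝ)..(2 * Real.pi), (γ * (σ - c 2) + axialVelocity V (axisPt σ t θ)) * ⟪V (axisPt σ t θ), rotZ θ (EuclideanSpace.single (0 : Fin 3) (1 : ℝ))⟫ := by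
  unfold circleAvg
  congr 1
  refine intervalIntegral.integral_congr fun θ _ => ?_
  simp only [(axisPt_apply σ t θ).2.2, inner_rotZ_single_zero_eq_radialVelocity V σ ht θ]

/-- `circleAvg (−(c₀ê_r,₀ + c₁ê_r,₁)V_z) σ t = (2π)⁻¹∫(−⟪c,R_θe₀⟫)V_z` (`t > 0`; the `offsetTerm` integrand). [folklore] -/
theorem circleAvg_offsetFlux_eq_slice (c : EuclideanSpace ℝ (Fin 3)) (V : EuclideanSpace ℝ (Fin 3) → EuclideanSpace ℝ (Fin 3))
    (σ : ℝ) {t : ℝ} (ht : 0 < t) :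
    circleAvg (fun y => (-(c 0 * eR y 0 + c 1 * eR y 1)) * axialVelocity V y) σ t = (1 / (2 * Real.pi)) * ∫ θ in (0 : ℝ)..(2 * Real.pi), (-⟪c, rotZ θ (EuclideanSpace.single (0 : Fin 3) (1 : ℝ))⟫) * axialVelocity V (axisPt σ t θ) := by
  unfold circleAvg
  congr 1
  refine intervalIntegral.integral_congr fun θ _ => ?_
  rw [← eR_axisPt σ ht θ, inner_eR_eq_components]

/-! ### Joint continuity of the slice integrands and derivatives of the slice integrals -/

/-- `θ ↦ R_θe₀` and `θ ↦ ⟪c, R_θe₀⟫` are continuous. [folklore] -/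
theorem continuous_inner_rotZ_single_zero (c : EuclideanSpace ℝ (Fin 3)) : Continuous fun θ : ℝ => ⟪c, rotZ θ (EuclideanSpace.single (0 : Fin 3) (1 : ℝ))⟫ :=
  continuous_const.inner continuous_rotZ_single_zero

/-- **`∂_t` of the slice radial flux**: `t ↦ ∫(γt + a)a dθ` has derivative `∫((γ + a_d)a + (γt + a)a_d) dθ` at every `t`
(`a = ⟪V∘axisPt, R_θe₀⟫`, `a_d = ⟪DV R_θe₀, R_θe₀⟫`; `V ∈ C¹`). [folklore] -/
theorem hasDerivAt_sliceRadialFlux_radius (hV : ContDiff ℝ 1 V) (γ σ t : ℝ) :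
    HasDerivAt (fun t => ∫ θ in (0 : ℝ)..(2 * Real.pi), (γ * t + ⟪V (axisPt σ t θ), rotZ θ (EuclideanSpace.single (0 : Fin 3) (1 : ℝ))⟫) * ⟪V (axisPt σ t θ), rotZ θ (EuclideanSpace.single (0 : Fin 3) (1 : ℝ))⟫)
      (∫ θ in (0 : ℝ)..(2 * Real.pi), ((γ + ⟪fderiv ℝ V (axisPt σ t θ) (rotZ θ (EuclideanSpace.single (0 : Fin 3) (1 : ℝ))), rotZ θ (EuclideanSpace.single (0 : Fin 3) (1 : ℝ))⟫) * ⟪V (axisPt σ t θ), rotZ θ (EuclideanSpace.single (0 : Fin 3) (1 : ℝ))⟫ + (γ * t + ⟪V (axisPt σ t θ), rotZ θ (EuclideanSpace.single (0 : Fin 3) (1 : ℝ))⟫) * ⟪fderiv ℝ V (axisPt σ t θ) (rotZ θ (EuclideanSpace.single (0 : Fin 3) (1 : ℝ))), rotZ θ (EuclideanSpace.single (0 : Fin 3) (1 : ℝ))⟫)) t := by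
  have hVd : Differentiable ℝ V := hV.differentiable one_ne_zero
  have hA : Continuous fun p : ℝ × ℝ × ℝ => ⟪V (axisPt p.1 p.2.1 p.2.2), rotZ p.2.2 (EuclideanSpace.single (0 : Fin 3) (1 : ℝ))⟫ := continuous_sliceA hV.continuous
  have hAD : Continuous fun p : ℝ × ℝ × ℝ => ⟪fderiv ℝ V (axisPt p.1 p.2.1 p.2.2) (rotZ p.2.2 (EuclideanSpace.single (0 : Fin 3) (1 : ℝ))), rotZ p.2.2 (EuclideanSpace.single (0 : Fin 3) (1 : ℝ))⟫ :=
    continuous_sliceEntry hV (u := fun θ => rotZ θ (EuclideanSpace.single (0 : Fin 3) (1 : ℝ))) (w := fun θ => rotZ θ (EuclideanSpace.single (0 : Fin 3) (1 : ℝ)))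
      continuous_rotZ_single_zero continuous_rotZ_single_zero
  refine hasDerivAt_intervalIntegral_of_continuous (F := fun t θ => (γ * t + ⟪V (axisPt σ t θ), rotZ θ (EuclideanSpace.single (0 : Fin 3) (1 : ℝ))⟫) * ⟪V (axisPt σ t θ), rotZ θ (EuclideanSpace.single (0 : Fin 3) (1 : ℝ))⟫)
    (F' := fun t θ => (γ + ⟪fderiv ℝ V (axisPt σ t θ) (rotZ θ (EuclideanSpace.single (0 : Fin 3) (1 : ℝ))), rotZ θ (EuclideanSpace.single (0 : Fin 3) (1 : ℝ))⟫) * ⟪V (axisPt σ t θ), rotZ θ (EuclideanSpace.single (0 : Fin 3) (1 : ℝ))⟫ + (γ * t + ⟪V (axisPt σ t θ), rotZ θ (EuclideanSpace.single (0 : Fin 3) (1 : ℝ))⟫) * ⟪fderiv ℝ V (axisPt σ t θ) (rotZ θ (EuclideanSpace.single (0 : Fin 3) (1 : ℝ))), rotZ θ (EuclideanSpace.single (0 : Fin 3) (1 : ℝ))⟫) ?_ ?_ ?_ 0 (2 * Real.pi) t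
  · intro t θ
    refine ((((hasDerivAt_id t).const_mul γ).add (hasDerivAt_sliceA_radius hVd σ t θ)).mul
      (hasDerivAt_sliceA_radius hVd σ t θ)).congr_deriv ?_
    simp only [id, mul_one, Pi.add_apply]
  · exact continuous_uncurry_slice ((((continuous_const.mul (continuous_fst.comp continuous_snd)).add hA).mul hA)) σ
  · exact continuous_uncurry_slice ((((continuous_const.add hAD).mul hA).add
      (((continuous_const.mul (continuous_fst.comp continuous_snd)).add hA).mul hAD))) σ

/-- **`∂_σ` of the slice end flux** (`endTermC` integrand): `σ ↦ ∫(γ(σ−c₂) + V_z)a dθ` has derivative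
`∫((γ + a_zz)a + (γ(σ−c₂) + V_z)a_zr) dθ` at every `σ` and every `t` (`a_zz = ⟪DV e_z, e_z⟫`, `a_zr = ⟪DV e_z, R_θe₀⟫`). [folklore] -/
theorem hasDerivAt_sliceEndFlux_height (hV : ContDiff ℝ 1 V) (γ : ℝ) (c : EuclideanSpace ℝ (Fin 3)) (σ t : ℝ) :
    HasDerivAt (fun σ => ∫ θ in (0 : ℝ)..(2 * Real.pi), (γ * (σ - c 2) + axialVelocity V (axisPt σ t θ)) * ⟪V (axisPt σ t θ), rotZ θ (EuclideanSpace.single (0 : Fin 3) (1 : ℝ))⟫)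
      (∫ θ in (0 : ℝ)..(2 * Real.pi), ((γ + ⟪fderiv ℝ V (axisPt σ t θ) eZ, eZ⟫) * ⟪V (axisPt σ t θ), rotZ θ (EuclideanSpace.single (0 : Fin 3) (1 : ℝ))⟫ + (γ * (σ - c 2) + axialVelocity V (axisPt σ t θ)) * ⟪fderiv ℝ V (axisPt σ t θ) eZ, rotZ θ (EuclideanSpace.single (0 : Fin 3) (1 : ℝ))⟫)) σ := by
  have hVd : Differentiable ℝ V := hV.differentiable one_ne_zero
  have hA : Continuous fun p : ℝ × ℝ × ℝ => ⟪V (axisPt p.1 p.2.1 p.2.2), rotZ p.2.2 (EuclideanSpace.single (0 : Fin 3) (1 : ℝ))⟫ := continuous_sliceA hV.continuous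
  have hC : Continuous fun p : ℝ × ℝ × ℝ => axialVelocity V (axisPt p.1 p.2.1 p.2.2) := continuous_sliceC hV.continuous
  have hAZZ : Continuous fun p : ℝ × ℝ × ℝ => ⟪fderiv ℝ V (axisPt p.1 p.2.1 p.2.2) eZ, eZ⟫ :=
    continuous_sliceEntry hV (u := fun _ => eZ) (w := fun _ => eZ) continuous_const continuous_const
  have hAZR : Continuous fun p : ℝ × ℝ × ℝ => ⟪fderiv ℝ V (axisPt p.1 p.2.1 p.2.2) eZ, rotZ p.2.2 (EuclideanSpace.single (0 : Fin 3) (1 : ℝ))⟫ :=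
    continuous_sliceEntry hV (u := fun _ => eZ) (w := fun θ => rotZ θ (EuclideanSpace.single (0 : Fin 3) (1 : ℝ))) continuous_const continuous_rotZ_single_zero
  refine hasDerivAt_intervalIntegral_of_continuous (F := fun σ θ => (γ * (σ - c 2) + axialVelocity V (axisPt σ t θ)) * ⟪V (axisPt σ t θ), rotZ θ (EuclideanSpace.single (0 : Fin 3) (1 : ℝ))⟫)
    (F' := fun σ θ => (γ + ⟪fderiv ℝ V (axisPt σ t θ) eZ, eZ⟫) * ⟪V (axisPt σ t θ), rotZ θ (EuclideanSpace.single (0 : Fin 3) (1 : ℝ))⟫ + (γ * (σ - c 2) + axialVelocity V (axisPt σ t θ)) * ⟪fderiv ℝ V (axisPt σ t θ) eZ, rotZ θ (EuclideanSpace.single (0 : Fin 3) (1 : ℝ))⟫) ?_ ?_ ?_ 0 (2 * Real.pi) σ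
  · intro σ θ
    refine (((((hasDerivAt_id σ).sub_const (c 2)).const_mul γ).add (hasDerivAt_sliceC_height hVd σ t θ)).mul
      (hasDerivAt_sliceA_height hVd σ t θ)).congr_deriv ?_
    simp only [id, mul_one, Pi.add_apply]
  · exact continuous_uncurry_radius ((((continuous_const.mul ((continuous_fst).sub continuous_const)).add hC).mul hA)) t
  · exact continuous_uncurry_radius ((((continuous_const.add hAZZ).mul hA).add
      (((continuous_const.mul ((continuous_fst).sub continuous_const)).add hC).mul hAZR))) t

/-- **`∂_σ` of the slice offset flux** (`offsetTerm` integrand): `σ ↦ ∫(−⟪c,R_θe₀⟫)V_z dθ` has derivative `∫(−⟪c,R_θe₀⟫)a_zz dθ`. [folklore] -/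
theorem hasDerivAt_sliceOffsetFlux_height (hV : ContDiff ℝ 1 V) (c : EuclideanSpace ℝ (Fin 3)) (σ t : ℝ) :
    HasDerivAt (fun σ => ∫ θ in (0 : ℝ)..(2 * Real.pi), (-⟪c, rotZ θ (EuclideanSpace.single (0 : Fin 3) (1 : ℝ))⟫) * axialVelocity V (axisPt σ t θ))
      (∫ θ in (0 : ℝ)..(2 * Real.pi), (-⟪c, rotZ θ (EuclideanSpace.single (0 : Fin 3) (1 : ℝ))⟫) * ⟪fderiv ℝ V (axisPt σ t θ) eZ, eZ⟫) σ := by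
  have hVd : Differentiable ℝ V := hV.differentiable one_ne_zero
  have hC : Continuous fun p : ℝ × ℝ × ℝ => axialVelocity V (axisPt p.1 p.2.1 p.2.2) := continuous_sliceC hV.continuous
  have hAZZ : Continuous fun p : ℝ × ℝ × ℝ => ⟪fderiv ℝ V (axisPt p.1 p.2.1 p.2.2) eZ, eZ⟫ :=
    continuous_sliceEntry hV (u := fun _ => eZ) (w := fun _ => eZ) continuous_const continuous_const
  have hCR : Continuous fun p : ℝ × ℝ × ℝ => -⟪c, rotZ p.2.2 (EuclideanSpace.single (0 : Fin 3) (1 : ℝ))⟫ :=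
    ((continuous_inner_rotZ_single_zero c).comp (continuous_snd.comp continuous_snd)).neg
  refine hasDerivAt_intervalIntegral_of_continuous (F := fun σ θ => (-⟪c, rotZ θ (EuclideanSpace.single (0 : Fin 3) (1 : ℝ))⟫) * axialVelocity V (axisPt σ t θ))
    (F' := fun σ θ => (-⟪c, rotZ θ (EuclideanSpace.single (0 : Fin 3) (1 : ℝ))⟫) * ⟪fderiv ℝ V (axisPt σ t θ) eZ, eZ⟫) ?_ ?_ ?_ 0 (2 * Real.pi) σ
  · intro σ θ
    exact (hasDerivAt_sliceC_height hVd σ t θ).const_mul _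
  · exact continuous_uncurry_radius (hCR.mul hC) t
  · exact continuous_uncurry_radius (hCR.mul hAZZ) t

/-! ### AX-2 in slice form: the derivative identity for `t > 0` -/

/-- **AX-2 in slice form**: for `t > 0`, with `Q(t) = circleAvg P σ t` and `A₁(t) = (2π)⁻¹∫(γt + a)a dθ`,
`(Q + A₁)'(t) = −[(1−3γ)(2π)⁻¹∫a + (2π)⁻¹∫((γ + a_zz)a + (γ(σ−c₂)+V_z)a_zr) − γ(2π)⁻¹∫(−⟪c,R_θe₀⟫)a_zz + t⁻¹(2π)⁻¹∫(a² − b²)]`. [folklore] -/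
theorem hasDerivAt_pressure_add_radialFlux (hprof : IsSelfSimilarEulerProfile γ c V P) (σ : ℝ) {t : ℝ} (ht : 0 < t) :
    HasDerivAt (fun t => circleAvg P σ t + (1 / (2 * Real.pi)) * ∫ θ in (0 : ℝ)..(2 * Real.pi), (γ * t + ⟪V (axisPt σ t θ), rotZ θ (EuclideanSpace.single (0 : Fin 3) (1 : ℝ))⟫) * ⟪V (axisPt σ t θ), rotZ θ (EuclideanSpace.single (0 : Fin 3) (1 : ℝ))⟫)
      (-((1 - 3 * γ) * ((1 / (2 * Real.pi)) * ∫ θ in (0 : ℝ)..(2 * Real.pi), ⟪V (axisPt σ t θ), rotZ θ (EuclideanSpace.single (0 : Fin 3) (1 : ℝ))⟫) +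
          ((1 / (2 * Real.pi)) * (∫ θ in (0 : ℝ)..(2 * Real.pi), ((γ + ⟪fderiv ℝ V (axisPt σ t θ) eZ, eZ⟫) * ⟪V (axisPt σ t θ), rotZ θ (EuclideanSpace.single (0 : Fin 3) (1 : ℝ))⟫ + (γ * (σ - c 2) + axialVelocity V (axisPt σ t θ)) * ⟪fderiv ℝ V (axisPt σ t θ) eZ, rotZ θ (EuclideanSpace.single (0 : Fin 3) (1 : ℝ))⟫)) -
            γ * ((1 / (2 * Real.pi)) * ∫ θ in (0 : ℝ)..(2 * Real.pi), (-⟪c, rotZ θ (EuclideanSpace.single (0 : Fin 3) (1 : ℝ))⟫) * ⟪fderiv ℝ V (axisPt σ t θ) eZ, eZ⟫)) +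
          t⁻¹ * ((1 / (2 * Real.pi)) * ∫ θ in (0 : ℝ)..(2 * Real.pi), (⟪V (axisPt σ t θ), rotZ θ (EuclideanSpace.single (0 : Fin 3) (1 : ℝ))⟫ ^ 2 - ⟪V (axisPt σ t θ), rotZ θ (EuclideanSpace.single (1 : Fin 3) (1 : ℝ))⟫ ^ 2)))) t := by
  have hV1 : ContDiff ℝ 1 V := hprof.contDiff_velocity.of_le (by norm_num)
  have hVd : ∀ θ, DifferentiableAt ℝ V (axisPt σ t θ) := fun θ => (hV1.differentiable one_ne_zero) _
  have hQ := hasDerivAt_circleAvg_pressure_radius hprof.contDiff_pressure σ ht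
  have hA1 := (hasDerivAt_sliceRadialFlux_radius hV1 γ σ t).const_mul (1 / (2 * Real.pi))
  have hsum := hQ.add hA1
  have cVc : Continuous fun θ : ℝ => V (axisPt σ t θ) := hV1.continuous.comp (continuous_axisPt_angle σ t)
  have cL : Continuous fun θ : ℝ => fderiv ℝ V (axisPt σ t θ) :=
    (hV1.continuous_fderiv one_ne_zero).comp (continuous_axisPt_angle σ t)
  have cA : Continuous fun θ : ℝ => ⟪V (axisPt σ t θ), rotZ θ (EuclideanSpace.single (0 : Fin 3) (1 : ℝ))⟫ := cVc.inner continuous_rotZ_single_zero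
  have cB : Continuous fun θ : ℝ => ⟪V (axisPt σ t θ), rotZ θ (EuclideanSpace.single (1 : Fin 3) (1 : ℝ))⟫ := cVc.inner continuous_rotZ_single_one
  have cC : Continuous fun θ : ℝ => axialVelocity V (axisPt σ t θ) := by
    simp_rw [axialVelocity_eq_inner_eZ]; exact cVc.inner continuous_const
  have cAD : Continuous fun θ : ℝ => ⟪fderiv ℝ V (axisPt σ t θ) (rotZ θ (EuclideanSpace.single (0 : Fin 3) (1 : ℝ))), rotZ θ (EuclideanSpace.single (0 : Fin 3) (1 : ℝ))⟫ := (cL.clm_apply continuous_rotZ_single_zero).inner continuous_rotZ_single_zero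
  have cAZZ : Continuous fun θ : ℝ => ⟪fderiv ℝ V (axisPt σ t θ) eZ, eZ⟫ := (cL.clm_apply continuous_const).inner continuous_const
  have cAZR : Continuous fun θ : ℝ => ⟪fderiv ℝ V (axisPt σ t θ) eZ, rotZ θ (EuclideanSpace.single (0 : Fin 3) (1 : ℝ))⟫ := (cL.clm_apply continuous_const).inner continuous_rotZ_single_zero
  have cCR : Continuous fun θ : ℝ => ⟪c, rotZ θ (EuclideanSpace.single (0 : Fin 3) (1 : ℝ))⟫ := continuous_inner_rotZ_single_zero c
  have cQ : Continuous fun θ : ℝ => fderiv ℝ P (axisPt σ t θ) (rotZ θ (EuclideanSpace.single (0 : Fin 3) (1 : ℝ))) :=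
    ((hprof.contDiff_pressure.continuous_fderiv one_ne_zero).comp (continuous_axisPt_angle σ t)).clm_apply
      continuous_rotZ_single_zero
  have hAX := radialLaw_circleAvg hprof σ ht
  have hpt : ∀ θ : ℝ, ⟪gradient P (axisPt σ t θ), eR (axisPt σ t θ)⟫ + (1 - 3 * γ) * radialVelocity V (axisPt σ t θ) +
      fderiv ℝ (fun y => (γ * cylRadius y + radialVelocity V y) * radialVelocity V y) (axisPt σ t θ) (eR (axisPt σ t θ)) +
      fderiv ℝ (fun y => (γ * (y 2 - c 2) + axialVelocity V y) * radialVelocity V y) (axisPt σ t θ) eZ -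
      γ * fderiv ℝ (fun y => (-(c 0 * eR y 0 + c 1 * eR y 1)) * axialVelocity V y) (axisPt σ t θ) eZ +
      (radialVelocity V (axisPt σ t θ) ^ 2 - swirlVelocity V (axisPt σ t θ) ^ 2) / cylRadius (axisPt σ t θ) =
      fderiv ℝ P (axisPt σ t θ) (rotZ θ (EuclideanSpace.single (0 : Fin 3) (1 : ℝ))) + (1 - 3 * γ) * ⟪V (axisPt σ t θ), rotZ θ (EuclideanSpace.single (0 : Fin 3) (1 : ℝ))⟫ +
        ((γ + ⟪fderiv ℝ V (axisPt σ t θ) (rotZ θ (EuclideanSpace.single (0 : Fin 3) (1 : ℝ))), rotZ θ (EuclideanSpace.single (0 : Fin 3) (1 : ℝ))⟫) * ⟪V (axisPt σ t θ), rotZ θ (EuclideanSpace.single (0 : Fin 3) (1 : ℝ))⟫ + (γ * t + ⟪V (axisPt σ t θ), rotZ θ (EuclideanSpace.single (0 : Fin 3) (1 : ℝ))⟫) * ⟪fderiv ℝ V (axisPt σ t θ) (rotZ θ (EuclideanSpace.single (0 : Fin 3) (1 : ℝ))), rotZ θ (EuclideanSpace.single (0 : Fin 3) (1 : ℝ))⟫)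 +
        ((γ + ⟪fderiv ℝ V (axisPt σ t θ) eZ, eZ⟫) * ⟪V (axisPt σ t θ), rotZ θ (EuclideanSpace.single (0 : Fin 3) (1 : ℝ))⟫ + (γ * (σ - c 2) + axialVelocity V (axisPt σ t θ)) * ⟪fderiv ℝ V (axisPt σ t θ) eZ, rotZ θ (EuclideanSpace.single (0 : Fin 3) (1 : ℝ))⟫) -
        γ * ((-⟪c, rotZ θ (EuclideanSpace.single (0 : Fin 3) (1 : ℝ))⟫) * ⟪fderiv ℝ V (axisPt σ t θ) eZ, eZ⟫) + t⁻¹ * (⟪V (axisPt σ t θ), rotZ θ (EuclideanSpace.single (0 : Fin 3) (1 : ℝ))⟫ ^ 2 - ⟪V (axisPt σ t θ), rotZ θ (EuclideanSpace.single (1 : Fin 3) (1 : ℝ))⟫ ^ 2) := by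
    intro θ
    rw [fderiv_radialFlux_eR σ ht θ (hVd θ), fderiv_axialFlux_eZ σ ht θ (hVd θ), fderiv_offsetFlux_eZ σ ht θ (hVd θ),
      cylRadius_axisPt σ ht.le θ, gradient, InnerProductSpace.toDual_symm_apply, radialVelocity, swirlVelocity,
      eR_axisPt σ ht θ, eTheta_axisPt σ ht θ, div_eq_inv_mul]
  unfold circleAvg at hAX
  rw [intervalIntegral.integral_congr (fun θ _ => hpt θ)] at hAX
  have iQ : IntervalIntegrable (fun θ => fderiv ℝ P (axisPt σ t θ) (rotZ θ (EuclideanSpace.single (0 : Fin 3) (1 : ℝ)))) volume 0 (2 * Real.pi) := cQ.intervalIntegrable _ _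
  have iA : IntervalIntegrable (fun θ => (1 - 3 * γ) * ⟪V (axisPt σ t θ), rotZ θ (EuclideanSpace.single (0 : Fin 3) (1 : ℝ))⟫) volume 0 (2 * Real.pi) := (cA.const_mul _).intervalIntegrable _ _
  have iF1 : IntervalIntegrable (fun θ => (γ + ⟪fderiv ℝ V (axisPt σ t θ) (rotZ θ (EuclideanSpace.single (0 : Fin 3) (1 : ℝ))), rotZ θ (EuclideanSpace.single (0 : Fin 3) (1 : ℝ))⟫) * ⟪V (axisPt σ t θ), rotZ θ (EuclideanSpace.single (0 : Fin 3) (1 : ℝ))⟫ + (γ * t + ⟪V (axisPt σ t θ), rotZ θ (EuclideanSpace.single (0 : Fin 3) (1 : ℝ))⟫) * ⟪fderiv ℝ V (axisPt σ t θ) (rotZ θ (EuclideanSpace.single (0 : Fin 3) (1 : ℝ))), rotZ θ (EuclideanSpace.single (0 : Fin 3) (1 : ℝ))⟫) volume 0 (2 * Real.pi) :=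
    (((continuous_const.add cAD).mul cA).add ((continuous_const.add cA).mul cAD)).intervalIntegrable _ _
  have iF2 : IntervalIntegrable (fun θ => (γ + ⟪fderiv ℝ V (axisPt σ t θ) eZ, eZ⟫) * ⟪V (axisPt σ t θ), rotZ θ (EuclideanSpace.single (0 : Fin 3) (1 : ℝ))⟫ + (γ * (σ - c 2) + axialVelocity V (axisPt σ t θ)) * ⟪fderiv ℝ V (axisPt σ t θ) eZ, rotZ θ (EuclideanSpace.single (0 : Fin 3) (1 : ℝ))⟫) volume 0 (2 * Real.pi) :=
    (((continuous_const.add cAZZ).mul cA).add ((continuous_const.add cC).mul cAZR)).intervalIntegrable _ _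
  have iF3 : IntervalIntegrable (fun θ => γ * ((-⟪c, rotZ θ (EuclideanSpace.single (0 : Fin 3) (1 : ℝ))⟫) * ⟪fderiv ℝ V (axisPt σ t θ) eZ, eZ⟫)) volume 0 (2 * Real.pi) :=
    ((cCR.neg.mul cAZZ).const_mul γ).intervalIntegrable _ _
  have iG : IntervalIntegrable (fun θ => t⁻¹ * (⟪V (axisPt σ t θ), rotZ θ (EuclideanSpace.single (0 : Fin 3) (1 : ℝ))⟫ ^ 2 - ⟪V (axisPt σ t θ), rotZ θ (EuclideanSpace.single (1 : Fin 3) (1 : ℝ))⟫ ^ 2)) volume 0 (2 * Real.pi) :=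
    (((cA.pow 2).sub (cB.pow 2)).const_mul t⁻¹).intervalIntegrable _ _
  rw [integral_add ((((iQ.add iA).add iF1).add iF2).sub iF3) iG, integral_sub (((iQ.add iA).add iF1).add iF2) iF3,
    integral_add ((iQ.add iA).add iF1) iF2, integral_add (iQ.add iA) iF1, integral_add iQ iA,
    intervalIntegral.integral_const_mul, intervalIntegral.integral_const_mul, intervalIntegral.integral_const_mul] at hAX
  -- identify the `Q'` slice integral with the `circleAvg` form of `hQ`
  have eQ : circleAvg (fun y => ⟪gradient P y, eR y⟫) σ t = (1 / (2 * Real.pi)) * ∫ θ in (0 : ℝ)..(2 * Real.pi), fderiv ℝ P (axisPt σ t θ) (rotZ θ (EuclideanSpace.single (0 : Fin 3) (1 : ℝ))) := by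
    unfold circleAvg
    congr 1
    refine intervalIntegral.integral_congr fun θ _ => ?_
    simp only [gradient, InnerProductSpace.toDual_symm_apply, eR_axisPt σ ht θ]
  rw [eQ] at hsum
  refine hsum.congr_deriv ?_
  linear_combination hAX

/-! ### The bound at the axis and AX-3 -/

/-- The slice `m = 2` integral `G(t) = ∫(a² − b²)dθ` is `C¹` in `t` with `G(0) = 0`, so `t⁻¹ G(t)` is bounded on `(0, T₀]`. [folklore] -/
theorem exists_bound_inv_mul_sliceSqDiff (hV : ContDiff ℝ 1 V) (σ : ℝ) {T₀ : ℝ} (hT : 0 ≤ T₀) :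
    ∃ M : ℝ, ∀ t ∈ Ioc (0 : ℝ) T₀, |t⁻¹ * ∫ θ in (0 : ℝ)..(2 * Real.pi), (⟪V (axisPt σ t θ), rotZ θ (EuclideanSpace.single (0 : Fin 3) (1 : ℝ))⟫ ^ 2 - ⟪V (axisPt σ t θ), rotZ θ (EuclideanSpace.single (1 : Fin 3) (1 : ℝ))⟫ ^ 2)| ≤ M := by
  have hVd : Differentiable ℝ V := hV.differentiable one_ne_zero
  have hA : Continuous fun p : ℝ × ℝ × ℝ => ⟪V (axisPt p.1 p.2.1 p.2.2), rotZ p.2.2 (EuclideanSpace.single (0 : Fin 3) (1 : ℝ))⟫ := continuous_sliceA hV.continuous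
  have hB : Continuous fun p : ℝ × ℝ × ℝ => ⟪V (axisPt p.1 p.2.1 p.2.2), rotZ p.2.2 (EuclideanSpace.single (1 : Fin 3) (1 : ℝ))⟫ := continuous_sliceB hV.continuous
  have hAD : Continuous fun p : ℝ × ℝ × ℝ => ⟪fderiv ℝ V (axisPt p.1 p.2.1 p.2.2) (rotZ p.2.2 (EuclideanSpace.single (0 : Fin 3) (1 : ℝ))), rotZ p.2.2 (EuclideanSpace.single (0 : Fin 3) (1 : ℝ))⟫ :=
    continuous_sliceEntry hV (u := fun θ => rotZ θ (EuclideanSpace.single (0 : Fin 3) (1 : ℝ))) (w := fun θ => rotZ θ (EuclideanSpace.single (0 : Fin 3) (1 : ℝ)))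
      continuous_rotZ_single_zero continuous_rotZ_single_zero
  have hBD : Continuous fun p : ℝ × ℝ × ℝ => ⟪fderiv ℝ V (axisPt p.1 p.2.1 p.2.2) (rotZ p.2.2 (EuclideanSpace.single (0 : Fin 3) (1 : ℝ))), rotZ p.2.2 (EuclideanSpace.single (1 : Fin 3) (1 : ℝ))⟫ :=
    continuous_sliceEntry hV (u := fun θ => rotZ θ (EuclideanSpace.single (0 : Fin 3) (1 : ℝ))) (w := fun θ => rotZ θ (EuclideanSpace.single (1 : Fin 3) (1 : ℝ)))
      continuous_rotZ_single_zero continuous_rotZ_single_one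
  -- `∂_t b = ⟪DV R_θe₀, R_θe₁⟫`
  have hb : ∀ t θ, HasDerivAt (fun t : ℝ => ⟪V (axisPt σ t θ), rotZ θ (EuclideanSpace.single (1 : Fin 3) (1 : ℝ))⟫) ⟪fderiv ℝ V (axisPt σ t θ) (rotZ θ (EuclideanSpace.single (0 : Fin 3) (1 : ℝ))), rotZ θ (EuclideanSpace.single (1 : Fin 3) (1 : ℝ))⟫ t := by
    intro t θ
    have h1 : HasDerivAt (fun t : ℝ => V (axisPt σ t θ)) (fderiv ℝ V (axisPt σ t θ) (rotZ θ (EuclideanSpace.single (0 : Fin 3) (1 : ℝ)))) t :=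
      (hVd _).hasFDerivAt.comp_hasDerivAt t (hasDerivAt_axisPt_radius' σ t θ)
    have h := h1.inner ℝ (hasDerivAt_const t (rotZ θ (EuclideanSpace.single (1 : Fin 3) (1 : ℝ))))
    simpa only [inner_zero_right, zero_add] using h
  -- derivative of `G`
  have hG : ∀ t, HasDerivAt (fun t => ∫ θ in (0 : ℝ)..(2 * Real.pi), (⟪V (axisPt σ t θ), rotZ θ (EuclideanSpace.single (0 : Fin 3) (1 : ℝ))⟫ ^ 2 - ⟪V (axisPt σ t θ), rotZ θ (EuclideanSpace.single (1 : Fin 3) (1 : ℝ))⟫ ^ 2))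
      (∫ θ in (0 : ℝ)..(2 * Real.pi), (2 * ⟪V (axisPt σ t θ), rotZ θ (EuclideanSpace.single (0 : Fin 3) (1 : ℝ))⟫ * ⟪fderiv ℝ V (axisPt σ t θ) (rotZ θ (EuclideanSpace.single (0 : Fin 3) (1 : ℝ))), rotZ θ (EuclideanSpace.single (0 : Fin 3) (1 : ℝ))⟫ - 2 * ⟪V (axisPt σ t θ), rotZ θ (EuclideanSpace.single (1 : Fin 3) (1 : ℝ))⟫ * ⟪fderiv ℝ V (axisPt σ t θ) (rotZ θ (EuclideanSpace.single (0 : Fin 3) (1 : ℝ))), rotZ θ (EuclideanSpace.single (1 : Fin 3) (1 : ℝ))⟫)) t := by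
    intro t
    refine hasDerivAt_intervalIntegral_of_continuous (F := fun t θ => ⟪V (axisPt σ t θ), rotZ θ (EuclideanSpace.single (0 : Fin 3) (1 : ℝ))⟫ ^ 2 - ⟪V (axisPt σ t θ), rotZ θ (EuclideanSpace.single (1 : Fin 3) (1 : ℝ))⟫ ^ 2)
      (F' := fun t θ => 2 * ⟪V (axisPt σ t θ), rotZ θ (EuclideanSpace.single (0 : Fin 3) (1 : ℝ))⟫ * ⟪fderiv ℝ V (axisPt σ t θ) (rotZ θ (EuclideanSpace.single (0 : Fin 3) (1 : ℝ))), rotZ θ (EuclideanSpace.single (0 : Fin 3) (1 : ℝ))⟫ - 2 * ⟪V (axisPt σ t θ), rotZ θ (EuclideanSpace.single (1 : Fin 3) (1 : ℝ))⟫ * ⟪fderiv ℝ V (axisPt σ t θ) (rotZ θ (EuclideanSpace.single (0 : Fin 3) (1 : ℝ))), rotZ θ (EuclideanSpace.single (1 : Fin 3) (1 : ℝ))⟫) ?_ ?_ ?_ 0 (2 * Real.pi) t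
    · intro t θ
      refine (((hasDerivAt_sliceA_radius hVd σ t θ).pow 2).sub ((hb t θ).pow 2)).congr_deriv ?_
      simp only [Nat.cast_ofNat]
      ring
    · exact continuous_uncurry_slice ((hA.pow 2).sub (hB.pow 2)) σ
    · exact continuous_uncurry_slice (((continuous_const.mul hA).mul hAD).sub ((continuous_const.mul hB).mul hBD)) σ
  -- bound of `G'` on `[0, T₀]`
  have hG'c : Continuous fun t => ∫ θ in (0 : ℝ)..(2 * Real.pi), (2 * ⟪V (axisPt σ t θ), rotZ θ (EuclideanSpace.single (0 : Fin 3) (1 : ℝ))⟫ * ⟪fderiv ℝ V (axisPt σ t θ) (rotZ θ (EuclideanSpace.single (0 : Fin 3) (1 : ℝ))), rotZ θ (EuclideanSpace.single (0 : Fin 3) (1 : ℝ))⟫ - 2 * ⟪V (axisPt σ t θ), rotZ θ (EuclideanSpace.single (1 : Fin 3) (1 : ℝ))⟫ * ⟪fderiv ℝ V (axisPt σ t θ) (rotZ θ (EuclideanSpace.single (0 : Fin 3) (1 : ℝ))), rotZ θ (EuclideanSpace.single (1 : Fin 3) (1 : ℝ))⟫) :=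
    intervalIntegral.continuous_parametric_intervalIntegral_of_continuous'
      (continuous_uncurry_slice (((continuous_const.mul hA).mul hAD).sub ((continuous_const.mul hB).mul hBD)) σ) 0 (2 * Real.pi)
  obtain ⟨K, hK⟩ := isCompact_Icc.exists_bound_of_continuousOn (hG'c.continuousOn (s := Icc (0 : ℝ) T₀))
  refine ⟨K, fun t ht => ?_⟩
  have hmv := (convex_Icc (0 : ℝ) T₀).norm_image_sub_le_of_norm_hasDerivWithin_le
    (f := fun t => ∫ θ in (0 : ℝ)..(2 * Real.pi), (⟪V (axisPt σ t θ), rotZ θ (EuclideanSpace.single (0 : Fin 3) (1 : ℝ))⟫ ^ 2 - ⟪V (axisPt σ t θ), rotZ θ (EuclideanSpace.single (1 : Fin 3) (1 : ℝ))⟫ ^ 2))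
    (fun t _ => (hG t).hasDerivWithinAt) (fun t ht' => hK t ht') (left_mem_Icc.2 hT) (Ioc_subset_Icc_self ht)
  rw [sliceSqDiff_zero, sub_zero, sub_zero, Real.norm_eq_abs, Real.norm_eq_abs, abs_of_pos ht.1] at hmv
  rw [abs_mul, abs_inv, abs_of_pos ht.1]
  calc t⁻¹ * |∫ θ in (0 : ℝ)..(2 * Real.pi), (⟪V (axisPt σ t θ), rotZ θ (EuclideanSpace.single (0 : Fin 3) (1 : ℝ))⟫ ^ 2 - ⟪V (axisPt σ t θ), rotZ θ (EuclideanSpace.single (1 : Fin 3) (1 : ℝ))⟫ ^ 2)| ≤ t⁻¹ * (K * t) :=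
        mul_le_mul_of_nonneg_left hmv (inv_nonneg.2 ht.1.le)
    _ = K := by rw [mul_comm K t, ← mul_assoc, inv_mul_cancel₀ ht.1.ne', one_mul]

/-- **K-AXIS AX-3 — THE RADIAL LAW INTEGRATED IN THE RADIUS (general centre `c`)**: for a `C²` self-similar Euler profile
`(1−γ)V + DV[γ(y−c) + V] + ∇P = 0`, `div V = 0`, every height `σ` and every `T₀ > 0`,
`P(σe_z) − circleAvg P σ T₀ = ∫₀^T₀ circleAvg(V_r² − V_θ²) σ t / t − ½(‖V(σe_z)‖² − V_z(σe_z)²) + (1−3γ)∫₀^T₀ circleAvg V_r σ t`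
`+ circleAvg((γr + V_r)V_r) σ T₀ + ∫₀^T₀ [(2π)⁻¹∫((γ + a_zz)a + (γ(σ−c₂) + V_z)a_zr)dθ − γ(2π)⁻¹∫(−⟪c,R_θe₀⟫)a_zz dθ] dt`,
the last bracket being `∂_σ` of the slice forms of the `endTermC` / `offsetTerm` integrands (`hasDerivAt_sliceEndFlux_height`,
`hasDerivAt_sliceOffsetFlux_height`, `circleAvg_endFlux_eq_slice`, `circleAvg_offsetFlux_eq_slice`).  FTC on `[0, T₀]` for the
continuous function `Q + A₁` (derivative from `hasDerivAt_pressure_add_radialFlux` on `(0, T₀)`, integrable thanks to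
`exists_bound_inv_mul_sliceSqDiff`), the axis values `circleAvg_radius_zero` and `sliceRadialFlux_zero`. [folklore] -/
theorem axisLaw_slice (hprof : IsSelfSimilarEulerProfile γ c V P) (σ : ℝ) {T₀ : ℝ} (hT : 0 < T₀) :
    P (σ • eZ) - circleAvg P σ T₀ =
      (∫ t in (0 : ℝ)..T₀, circleAvg (fun y => radialVelocity V y ^ 2 - swirlVelocity V y ^ 2) σ t / t)
        - (1 / 2) * (‖V (σ • eZ)‖ ^ 2 - axialVelocity V (σ • eZ) ^ 2)
        + (1 - 3 * γ) * (∫ t in (0 : ℝ)..T₀, circleAvg (radialVelocity V) σ t)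
        + circleAvg (fun y => (γ * cylRadius y + radialVelocity V y) * radialVelocity V y) σ T₀
        + ∫ t in (0 : ℝ)..T₀, ((1 / (2 * Real.pi)) * (∫ θ in (0 : ℝ)..(2 * Real.pi), ((γ + ⟪fderiv ℝ V (axisPt σ t θ) eZ, eZ⟫) * ⟪V (axisPt σ t θ), rotZ θ (EuclideanSpace.single (0 : Fin 3) (1 : ℝ))⟫ + (γ * (σ - c 2) + axialVelocity V (axisPt σ t θ)) * ⟪fderiv ℝ V (axisPt σ t θ) eZ, rotZ θ (EuclideanSpace.single (0 : Fin 3) (1 : ℝ))⟫))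
            - γ * ((1 / (2 * Real.pi)) * ∫ θ in (0 : ℝ)..(2 * Real.pi), (-⟪c, rotZ θ (EuclideanSpace.single (0 : Fin 3) (1 : ℝ))⟫) * ⟪fderiv ℝ V (axisPt σ t θ) eZ, eZ⟫)) := by
  have hV1 : ContDiff ℝ 1 V := hprof.contDiff_velocity.of_le (by norm_num)
  have hA : Continuous fun p : ℝ × ℝ × ℝ => ⟪V (axisPt p.1 p.2.1 p.2.2), rotZ p.2.2 (EuclideanSpace.single (0 : Fin 3) (1 : ℝ))⟫ := continuous_sliceA hV1.continuous
  have hB : Continuous fun p : ℝ × ℝ × ℝ => ⟪V (axisPt p.1 p.2.1 p.2.2), rotZ p.2.2 (EuclideanSpace.single (1 : Fin 3) (1 : ℝ))⟫ := continuous_sliceB hV1.continuous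
  have hC : Continuous fun p : ℝ × ℝ × ℝ => axialVelocity V (axisPt p.1 p.2.1 p.2.2) := continuous_sliceC hV1.continuous
  have hAZZ : Continuous fun p : ℝ × ℝ × ℝ => ⟪fderiv ℝ V (axisPt p.1 p.2.1 p.2.2) eZ, eZ⟫ :=
    continuous_sliceEntry hV1 (u := fun _ => eZ) (w := fun _ => eZ) continuous_const continuous_const
  have hAZR : Continuous fun p : ℝ × ℝ × ℝ => ⟪fderiv ℝ V (axisPt p.1 p.2.1 p.2.2) eZ, rotZ p.2.2 (EuclideanSpace.single (0 : Fin 3) (1 : ℝ))⟫ :=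
    continuous_sliceEntry hV1 (u := fun _ => eZ) (w := fun θ => rotZ θ (EuclideanSpace.single (0 : Fin 3) (1 : ℝ))) continuous_const continuous_rotZ_single_zero
  have hCR : Continuous fun p : ℝ × ℝ × ℝ => -⟪c, rotZ p.2.2 (EuclideanSpace.single (0 : Fin 3) (1 : ℝ))⟫ :=
    ((continuous_inner_rotZ_single_zero c).comp (continuous_snd.comp continuous_snd)).neg
  -- the four `t`-functions: R, E₂', E₃', G (θ-integrals, continuous in `t`)
  have cR : Continuous fun t : ℝ => ∫ θ in (0 : ℝ)..(2 * Real.pi), ⟪V (axisPt σ t θ), rotZ θ (EuclideanSpace.single (0 : Fin 3) (1 : ℝ))⟫ :=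
    intervalIntegral.continuous_parametric_intervalIntegral_of_continuous' (continuous_uncurry_slice hA σ) 0 (2 * Real.pi)
  have cE2 : Continuous fun t : ℝ => ∫ θ in (0 : ℝ)..(2 * Real.pi), ((γ + ⟪fderiv ℝ V (axisPt σ t θ) eZ, eZ⟫) * ⟪V (axisPt σ t θ), rotZ θ (EuclideanSpace.single (0 : Fin 3) (1 : ℝ))⟫ + (γ * (σ - c 2) + axialVelocity V (axisPt σ t θ)) * ⟪fderiv ℝ V (axisPt σ t θ) eZ, rotZ θ (EuclideanSpace.single (0 : Fin 3) (1 : ℝ))⟫) :=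
    intervalIntegral.continuous_parametric_intervalIntegral_of_continuous'
      (continuous_uncurry_slice ((((continuous_const.add hAZZ).mul hA).add
        (((continuous_const.mul ((continuous_fst).sub continuous_const)).add hC).mul hAZR))) σ) 0 (2 * Real.pi)
  have cE3 : Continuous fun t : ℝ => ∫ θ in (0 : ℝ)..(2 * Real.pi), (-⟪c, rotZ θ (EuclideanSpace.single (0 : Fin 3) (1 : ℝ))⟫) * ⟪fderiv ℝ V (axisPt σ t θ) eZ, eZ⟫ :=
    intervalIntegral.continuous_parametric_intervalIntegral_of_continuous' (continuous_uncurry_slice (hCR.mul hAZZ) σ) 0 (2 * Real.pi)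
  have cG : Continuous fun t : ℝ => ∫ θ in (0 : ℝ)..(2 * Real.pi), (⟪V (axisPt σ t θ), rotZ θ (EuclideanSpace.single (0 : Fin 3) (1 : ℝ))⟫ ^ 2 - ⟪V (axisPt σ t θ), rotZ θ (EuclideanSpace.single (1 : Fin 3) (1 : ℝ))⟫ ^ 2) :=
    intervalIntegral.continuous_parametric_intervalIntegral_of_continuous' (continuous_uncurry_slice ((hA.pow 2).sub (hB.pow 2)) σ) 0 (2 * Real.pi)
  have cA1 : Continuous fun t : ℝ => ∫ θ in (0 : ℝ)..(2 * Real.pi), (γ * t + ⟪V (axisPt σ t θ), rotZ θ (EuclideanSpace.single (0 : Fin 3) (1 : ℝ))⟫) * ⟪V (axisPt σ t θ), rotZ θ (EuclideanSpace.single (0 : Fin 3) (1 : ℝ))⟫ :=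
    intervalIntegral.continuous_parametric_intervalIntegral_of_continuous'
      (continuous_uncurry_slice ((((continuous_const.mul (continuous_fst.comp continuous_snd)).add hA).mul hA)) σ) 0 (2 * Real.pi)
  -- integrability of the derivative on `[0, T₀]`
  obtain ⟨M, hM⟩ := exists_bound_inv_mul_sliceSqDiff hV1 σ hT.le
  have iG : IntervalIntegrable (fun t => t⁻¹ * ((1 / (2 * Real.pi)) * ∫ θ in (0 : ℝ)..(2 * Real.pi), (⟪V (axisPt σ t θ), rotZ θ (EuclideanSpace.single (0 : Fin 3) (1 : ℝ))⟫ ^ 2 - ⟪V (axisPt σ t θ), rotZ θ (EuclideanSpace.single (1 : Fin 3) (1 : ℝ))⟫ ^ 2))) volume 0 T₀ := by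
    have h := (intervalIntegrable_inv_mul_of_bound cG hT.le hM).const_mul (1 / (2 * Real.pi))
    refine h.congr ?_  -- same function up to rearrangement
    intro t _
    ring
  have iX : IntervalIntegrable (fun t => (1 - 3 * γ) * ((1 / (2 * Real.pi)) * ∫ θ in (0 : ℝ)..(2 * Real.pi), ⟪V (axisPt σ t θ), rotZ θ (EuclideanSpace.single (0 : Fin 3) (1 : ℝ))⟫)) volume 0 T₀ :=
    (continuous_const.mul (continuous_const.mul cR)).intervalIntegrable _ _
  have iYZ : IntervalIntegrable (fun t => (1 / (2 * Real.pi)) * (∫ θ in (0 : ℝ)..(2 * Real.pi), ((γ + ⟪fderiv ℝ V (axisPt σ t θ) eZ, eZ⟫) * ⟪V (axisPt σ t θ), rotZ θ (EuclideanSpace.single (0 : Fin 3) (1 : ℝ))⟫ + (γ * (σ - c 2) + axialVelocity V (axisPt σ t θ)) * ⟪fderiv ℝ V (axisPt σ t θ) eZ, rotZ θ (EuclideanSpace.single (0 : Fin 3) (1 : ℝ))⟫)) -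
      γ * ((1 / (2 * Real.pi)) * ∫ θ in (0 : ℝ)..(2 * Real.pi), (-⟪c, rotZ θ (EuclideanSpace.single (0 : Fin 3) (1 : ℝ))⟫) * ⟪fderiv ℝ V (axisPt σ t θ) eZ, eZ⟫)) volume 0 T₀ :=
    ((continuous_const.mul cE2).sub (continuous_const.mul (continuous_const.mul cE3))).intervalIntegrable _ _
  -- FTC on `[0, T₀]` for `Q + A₁`
  have hFTC := integral_eq_sub_of_hasDeriv_right_of_le hT.le
    (f := fun t => circleAvg P σ t + (1 / (2 * Real.pi)) * ∫ θ in (0 : ℝ)..(2 * Real.pi), (γ * t + ⟪V (axisPt σ t θ), rotZ θ (EuclideanSpace.single (0 : Fin 3) (1 : ℝ))⟫) * ⟪V (axisPt σ t θ), rotZ θ (EuclideanSpace.single (0 : Fin 3) (1 : ℝ))⟫)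
    (((continuous_circleAvg_radius hprof.contDiff_pressure.continuous σ).add (continuous_const.mul cA1)).continuousOn)
    (fun t ht => (hasDerivAt_pressure_add_radialFlux hprof σ ht.1).hasDerivWithinAt)
    (((iX.add iYZ).add iG).neg.congr (fun t _ => by simp only [Pi.neg_apply]))
  -- evaluate: integral of the derivative, split; the values at `0` and `T₀`
  rw [intervalIntegral.integral_neg, integral_add (iX.add iYZ) iG, integral_add iX iYZ, intervalIntegral.integral_const_mul,
    circleAvg_radius_zero P σ, sliceRadialFlux_zero γ V σ, ← circleAvg_radialFlux_eq_slice γ V σ hT] at hFTC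
  -- rewrite the `circleAvg` integrals on `(0, T₀]` in slice form (they agree for `t > 0`)
  have e1 : ∫ t in (0 : ℝ)..T₀, circleAvg (fun y => radialVelocity V y ^ 2 - swirlVelocity V y ^ 2) σ t / t =
      ∫ t in (0 : ℝ)..T₀, t⁻¹ * ((1 / (2 * Real.pi)) * ∫ θ in (0 : ℝ)..(2 * Real.pi), (⟪V (axisPt σ t θ), rotZ θ (EuclideanSpace.single (0 : Fin 3) (1 : ℝ))⟫ ^ 2 - ⟪V (axisPt σ t θ), rotZ θ (EuclideanSpace.single (1 : Fin 3) (1 : ℝ))⟫ ^ 2)) := by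
    rw [intervalIntegral.integral_of_le hT.le, intervalIntegral.integral_of_le hT.le]
    refine setIntegral_congr_fun measurableSet_Ioc fun t ht => ?_
    rw [circleAvg_sqDiff_eq_slice V σ ht.1, div_eq_inv_mul]
  have e2 : ∫ t in (0 : ℝ)..T₀, circleAvg (radialVelocity V) σ t = ∫ t in (0 : ℝ)..T₀, (1 / (2 * Real.pi)) * ∫ θ in (0 : ℝ)..(2 * Real.pi), ⟪V (axisPt σ t θ), rotZ θ (EuclideanSpace.single (0 : Fin 3) (1 : ℝ))⟫ := by
    rw [intervalIntegral.integral_of_le hT.le, intervalIntegral.integral_of_le hT.le]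
    refine setIntegral_congr_fun measurableSet_Ioc fun t ht => ?_
    rw [circleAvg_radialVelocity_eq_slice V σ ht.1]
  rw [e1, e2]
  linarith [hFTC]

end Summit.NavierStokesRegularity.NavierStokesRegularity.Theorems.PowerGaugeEulerLiouville.HoopCore

end
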